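import Summits.ResolutionOfSingularities.ResolutionOfSingularities.Theorems.PurelyInseparableDim4ResConeGoodModuloFrozen
import Summits.ResolutionOfSingularities.ResolutionOfSingularities.Theorems.PurelyInseparableDim4ResConePureGameTail
import HarnessLib
import HarnessLib.Audit.Tags

/-!
# Purely inseparable four-folds — EVERY BINARY-CONE TRAP CARRIES A FROZEN LETTER, every prime `p`, every shade `d < p`
# (K2(p) lane, SLICE C; `good_or_permanent` / `good_modulo_frozen` with the GOOD branch emptied by `no_eventuallyGood_tail`;
# file-holder res-dim4-p-5 g5)

[OURS · counted 0 · cell `res-dim4-pi` · K2(p) lane, slice C (general-`p` programme) · seat p-5 g5.]  Nothing here proves K2(p) for any `p`,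
`NoIsolatedTrap p p` or resolution of singularities in dimension ≥ 4 / characteristic `p` — NOT proved; corollaries about OUR frame's
witnessed `Step0 p` chains.  AI kernel work, weaker than expert review.

* **`exists_permanent_letter (p) (hdp : d < p)`** — on a witnessed isolated above-floor `Step0 p` chain with `x^{r₀} ∣ F₀`, constant shade
  `d < p` and `e_G ≡ 2` from `k₀`, some boundary letter is PERMANENT: weight `≥ 1`, never charted, never translated from some time on.
* **`good_modulo_frozen_nonempty (p) (hdp : d < p)`** — `good_modulo_frozen` with the frozen set NON-EMPTY: from some `M ≥ k₀`, a set `P` of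
  ONE OR TWO permanent letters of frozen light total weight (`d + Σ_P r_M < p`) outside which every state is GOOD.
[cite: CossartJannsenSaito2020, Thm. 3.10(4), Thm. 3.14, Thm. 9.3, Lemma 13.2] [cite: HauserPerlega2019PRIMS, §2 (transform D′ of D)]
bears_on: LADDER-RESOLUTION:D157-DOOR2 (res-dim4-pi · K2(p) = `RidgeBudget.NoAboveFloorTrap p p` · TAIL(p, d, 2) ⊆ «frozen letter present»).
Supports stmt-ResolutionOfSingularities-16155 (helper).
-/

set_option linter.dupNamespace false -- mandated namespace of this single-conjunct summit

noncomputable section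

namespace Summit.ResolutionOfSingularities.ResolutionOfSingularities.Theorems.PIDim4

namespace ResCone

open MvPolynomial Finset
open Literature.AlgebraicGeometry.Resolution
open Literature.AlgebraicGeometry.Resolution.CentreBlowup
open Literature.AlgebraicGeometry.Resolution.Hauser2010
open Literature.AlgebraicGeometry.Resolution.HauserPerlega2019

variable {K : Type} [Field K] [DecidableEq K] (p : ℕ) [Fact p.Prime] [CharP K p]

/-- **EVERY BINARY-CONE TRAP HAS A PERMANENT LETTER** (every prime `p`, every shade `d < p`): on a witnessed isolated above-floor `Step0 p`
chain with `x^{r₀} ∣ F₀`, constant shade `d` and `e_G ≡ 2` from `k₀`, some letter `z` has weight `≥ 1` and is neither charted nor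
translated at any step from some time `M ≥ k₀` on. [OURS] [cite: CossartJannsenSaito2020, Thm. 3.10(4), Thm. 3.14, Thm. 9.3] -/
theorem exists_permanent_letter {c : ℕ → State K} {j : ℕ → Fin 4} {b : ℕ → Fin 4 → K}
    (hc : ∀ k, IsIsolated p (c k).F ∧ Step0 p (c k) (c (k + 1))) (hw : FreeTail.IsWitnessedChain p c j b)
    (hr0 : ∀ e ∈ (c 0).F.support, (c 0).r ≤ e) (hfloor : ∀ k, ordZero (c k).F ≠ p) {k₀ d : ℕ} (hdp : d < p)
    (hshade : ∀ k, k₀ ≤ k → (c k).shade = (d : ℕ∞)) (he : ∀ k, k₀ ≤ k → Module.finrank K (resVertex (c k)) = 2) :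
    ∃ M, k₀ ≤ M ∧ ∃ z : Fin 4, ∀ m, M ≤ m → 1 ≤ (c m).r z ∧ z ≠ j m ∧ b m z = 0 := by
  rcases good_or_permanent p hc hw hr0 hfloor hshade he with ⟨M, hM, hG⟩ | h
  · exact absurd (no_eventuallyGood_tail p hc hw hr0 hfloor hdp hshade he hM hG) not_false
  · exact h

/-- **GOOD MODULO A NON-EMPTY FROZEN LIGHT SET** (every prime `p`, every shade `d < p`): `good_modulo_frozen` with `P.Nonempty` — the
pure two-letter game (`P = ∅`) being empty by `no_eventuallyGood_tail`. [OURS]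
[cite: CossartJannsenSaito2020, Thm. 3.10(4), Thm. 3.14, Thm. 9.3, Lemma 13.2] -/
theorem good_modulo_frozen_nonempty {c : ℕ → State K} {j : ℕ → Fin 4} {b : ℕ → Fin 4 → K}
    (hc : ∀ k, IsIsolated p (c k).F ∧ Step0 p (c k) (c (k + 1))) (hw : FreeTail.IsWitnessedChain p c j b)
    (hr0 : ∀ e ∈ (c 0).F.support, (c 0).r ≤ e) (hfloor : ∀ k, ordZero (c k).F ≠ p) {k₀ d : ℕ} (hdp : d < p)
    (hshade : ∀ k, k₀ ≤ k → (c k).shade = (d : ℕ∞)) (he : ∀ k, k₀ ≤ k → Module.finrank K (resVertex (c k)) = 2) :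
    ∃ M, k₀ ≤ M ∧ ∃ P : Finset (Fin 4), P.Nonempty ∧ P.card ≤ 2 ∧ d + ∑ z ∈ P, (c M).r z < p ∧
      (∀ z ∈ P, ∀ m, M ≤ m → 1 ≤ (c m).r z ∧ z ≠ j m ∧ b m z = 0) ∧
      (∀ m, M ≤ m → ((∃ x y : Fin 4, ∀ i, i ∉ P → i ≠ x → i ≠ y → (c m).r i = 0) ∧
          (∀ x y : Fin 4, x ∉ P → y ∉ P → x ≠ y → 1 ≤ (c m).r x → 1 ≤ (c m).r y →
            ∀ v ∈ resVertex (c m), v x = 0 → v y = 0 → v = 0))) := by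
  obtain ⟨M, hM, P, hcard, hlight, hperm, hgood⟩ := good_modulo_frozen p hc hw hr0 hfloor hdp hshade he
  refine ⟨M, hM, P, ?_, hcard, hlight, hperm, hgood⟩
  rw [Finset.nonempty_iff_ne_empty]
  rintro rfl
  refine no_eventuallyGood_tail p hc hw hr0 hfloor hdp hshade he hM fun m hm => ?_
  obtain ⟨⟨x, y, hxy⟩, hTT⟩ := hgood m hm
  exact ⟨⟨x, y, fun i => hxy i (Finset.notMem_empty i)⟩,
    fun x y => hTT x y (Finset.notMem_empty x) (Finset.notMem_empty y)⟩

end ResCone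

end Summit.ResolutionOfSingularities.ResolutionOfSingularities.Theorems.PIDim4

end
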